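import Literature.AlgebraicGeometry.Motives.HodgeStructureWeilOperator
import Literature.AlgebraicGeometry.Motives.HodgeStructureWeil
import Literature.AlgebraicGeometry.Motives.HodgeStructurePolarizationAdjointPoints
import HarnessLib

/-!
# The Hodge filtration of a polarized Hodge structure is self-orthogonal: `F^a = (F^{n+1-a})^⊥`

Family `hodge`, layer `Literature/AlgebraicGeometry/Motives`. Theorems only (no definition, no named
fact). Written by the prover seat `hodge-nonav-prover-Ax` (g11, cell `hodge-nonav`) for the programme
«GRIFFITHS-SURFACES» (route `HodgeConjecture/CyclicUnitaryPowers`): in weight `2` it says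
`F¹H² = (F²H²)^⊥`, so that the whole Hodge filtration of a polarized weight-`2` structure is determined
by `F² = H^{2,0}` — the step that reduces Griffiths' holomorphy of the Hodge bundles of a family of
SURFACES to the holomorphic variation of the holomorphic `2`-forms (residues, for hypersurfaces).

For a Hodge structure `H` of weight `n` on `V` with polarization `Q` (tree convention
`Motives.HodgeStructure.Polarization`: `Q` rational, `(-1)ⁿ`-symmetric, first Hodge–Riemann relation
`Q_ℂ(F^a, F^{n+1-a}) = 0`, second relation `i^{p-q} Q_ℂ(x, x̄) > 0` on `V^{p,q} ∖ 0`):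

* `mem_F_of_forall_pieceProj_eq_zero` — a vector whose Hodge components `x^{p,n-p}`, `p < a`, vanish
  lies in `F^a` (Deligne, Hodge II, 1.2.5: `F^a = ⊕_{p ≥ a} V^{p,n-p}`);
* `Polarization.form_conj_pieceProj` — `Q_ℂ(x, conj x^{p}) = Q_ℂ(x^{p}, conj x^{p})` (the Hodge
  decomposition is `Q(·, conj ·)`-orthogonal, Voisin I Def. 7.7 (i));
* `Polarization.pieceProj_eq_zero_of_form_conj_self_eq_zero` — `Q_ℂ(x^{p}, conj x^{p}) = 0` forces
  `x^{p} = 0` (second Hodge–Riemann relation);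
* **`Polarization.mem_F_iff_forall_form_eq_zero`** — `x ∈ F^a ↔ ∀ y ∈ F^{n+1-a}, Q_ℂ(x, y) = 0`,
  i.e. **`F^a = (F^{n+1-a})^{⊥_Q}`** (Voisin I §7.1.2: the first relation says `F^a ⊆ (F^{n+1-a})^⊥`,
  and both have dimension `Σ_{p ≥ a} h^{p,n-p}` by non-degeneracy; here: for `p < a`,
  `conj x^{p} ∈ V^{n-p,p} ⊆ F^{n+1-a}`, so `0 = Q_ℂ(x, conj x^{p}) = Q_ℂ(x^{p}, conj x^{p})`, hence
  `x^{p} = 0`); `Polarization.mem_F_iff_forall_form_eq_zero'` — the same with `Q_ℂ(y, x)`;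
  `Polarization.F_eq_orthogonal` — as an equality of submodules with Mathlib's
  `LinearMap.BilinForm.orthogonal`.

## References

* [VoisinHodgeI2002] C. Voisin, Hodge Theory and Complex Algebraic Geometry I, CUP 2002, §7.1.2,
  Def. 7.7 and the discussion after it (the period domain as a subset of a flag manifold cut out by
  `F^a = (F^{n+1-a})^⊥`), §10.1.2.
* [CarlsonMullerStachPeters2017] J. Carlson, S. Müller-Stach, C. Peters, Period Mappings and Period
  Domains, 2nd ed., §4.4 (the first bilinear relation as `F^{n+1-a} = (F^a)^⊥`).
* [DeligneHodgeII1971] P. Deligne, Théorie de Hodge II, Publ. Math. IHÉS 40 (1971), 1.2.5, 2.1.15.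
-/

noncomputable section

open scoped TensorProduct

universe u

namespace Literature.AlgebraicGeometry.Motives

namespace HodgeStructure

variable {V : Type u} [AddCommGroup V] [Module ℚ V] {n : ℤ}

/-- **A vector whose Hodge components `x^{p,n-p}`, `p < a`, vanish lies in `F^a`**
(`x = Σ_p x^{p,n-p}` and `V^{p,n-p} ⊆ F^p ⊆ F^a` for `p ≥ a`). [cite: DeligneHodgeII1971, 1.2.5] -/
theorem mem_F_of_forall_pieceProj_eq_zero (H : HodgeStructure V n) {a : ℤ} {x : ℂ ⊗[ℚ] V}
    (h : ∀ p < a, H.pieceProj p x = 0) : x ∈ H.F a := by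
  rw [← sum_pieceProj H x]
  refine Submodule.sum_mem _ fun p _ => ?_
  by_cases hpa : p < a
  · rw [h p hpa]
    exact Submodule.zero_mem _
  · exact H.antitone_F (not_lt.1 hpa) (piece_le_F H p (n - p) (pieceProj_mem H p x))

namespace Polarization

variable {H : HodgeStructure V n} (Q : Polarization H)

/-- **`Q_ℂ(x, conj x^{p}) = Q_ℂ(x^{p}, conj x^{p})`**: in `x = Σ_{p'} x^{p'}` only the component
`p' = p` pairs non-trivially with `conj x^{p} ∈ V^{n-p,p}` (the Hodge decomposition is orthogonal
for `Q(·, conj ·)`). [cite: VoisinHodgeI2002, §7.1.2 Def. 7.7] -/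
theorem form_conj_pieceProj (p : ℤ) (x : ℂ ⊗[ℚ] V) :
    Q.form.baseChange ℂ x (conj (H.pieceProj p x)) =
      Q.form.baseChange ℂ (H.pieceProj p x) (conj (H.pieceProj p x)) := by
  have hx : Q.form.baseChange ℂ x =
      Q.form.baseChange ℂ (∑ p' ∈ H.pieceSupport x, H.pieceProj p' x) := by
    rw [sum_pieceProj H x]
  rw [hx, map_sum, LinearMap.sum_apply, Finset.sum_eq_single p]
  · intro p' _ hp'
    exact Q.form_piece_conj_piece hp' (pieceProj_mem H p' x) (pieceProj_mem H p x)
  · intro hp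
    rw [pieceProj_eq_zero_of_not_mem_pieceSupport H hp, map_zero, LinearMap.zero_apply]

/-- **`Q_ℂ(x^{p}, conj x^{p}) = 0` forces `x^{p} = 0`** (second Hodge–Riemann relation:
`i^{p}(i^{n-p})⁻¹ Q_ℂ(z, z̄) > 0` for `0 ≠ z ∈ V^{p,n-p}`). [cite: VoisinHodgeI2002, §7.1.2 Def. 7.7] -/
theorem pieceProj_eq_zero_of_form_conj_self_eq_zero {p : ℤ} {x : ℂ ⊗[ℚ] V}
    (h : Q.form.baseChange ℂ (H.pieceProj p x) (conj (H.pieceProj p x)) = 0) :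
    H.pieceProj p x = 0 := by
  by_contra hne
  obtain ⟨r, hr, hr'⟩ := Q.pos p (n - p) (by ring) _ (pieceProj_mem H p x) hne
  have h0 : (r : ℂ) = 0 := by rw [← hr', h, mul_zero]
  exact hr.ne' (Complex.ofReal_eq_zero.1 h0)

/-- **The Hodge filtration is self-orthogonal for a polarization: `x ∈ F^a ↔ Q_ℂ(x, F^{n+1-a}) = 0`,
i.e. `F^a = (F^{n+1-a})^⊥`.** (`→`) is the first Hodge–Riemann relation. (`←`): for `p < a` the
vector `conj x^{p} ∈ V^{n-p,p}` lies in `F^{n-p} ⊆ F^{n+1-a}`, so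
`0 = Q_ℂ(x, conj x^{p}) = Q_ℂ(x^{p}, conj x^{p})`, whence `x^{p} = 0` by the second relation, and
`x = Σ_{p ≥ a} x^{p} ∈ F^a`. [cite: VoisinHodgeI2002, §7.1.2 Def. 7.7 and §10.1.2]
[cite: CarlsonMullerStachPeters2017, §4.4] -/
theorem mem_F_iff_forall_form_eq_zero (a : ℤ) (x : ℂ ⊗[ℚ] V) :
    x ∈ H.F a ↔ ∀ y ∈ H.F (n + 1 - a), Q.form.baseChange ℂ x y = 0 := by
  refine ⟨fun hx y hy => Q.form_apply_eq_zero a x hx y hy, fun h => ?_⟩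
  refine mem_F_of_forall_pieceProj_eq_zero H fun p hp => ?_
  refine Q.pieceProj_eq_zero_of_form_conj_self_eq_zero ?_
  rw [← Q.form_conj_pieceProj p x]
  refine h _ ?_
  have hc : conj (H.pieceProj p x) ∈ H.piece (n - p) p := conj_mem_piece H (pieceProj_mem H p x)
  exact H.antitone_F (show n + 1 - a ≤ n - p by omega) (piece_le_F H (n - p) p hc)

/-- The same with the arguments of `Q_ℂ` swapped (`Q_ℂ` is `(-1)ⁿ`-symmetric):
`x ∈ F^a ↔ ∀ y ∈ F^{n+1-a}, Q_ℂ(y, x) = 0`. [cite: VoisinHodgeI2002, §7.1.2 Def. 7.7] -/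
theorem mem_F_iff_forall_form_eq_zero' (a : ℤ) (x : ℂ ⊗[ℚ] V) :
    x ∈ H.F a ↔ ∀ y ∈ H.F (n + 1 - a), Q.form.baseChange ℂ y x = 0 := by
  rw [Q.mem_F_iff_forall_form_eq_zero a x]
  refine forall₂_congr fun y _ => ?_
  rw [Q.baseChange_form_swap ℂ x y]
  have hu : (((n.negOnePow : ℤˣ) : ℤ) : ℂ) ≠ 0 := by
    rw [Int.cast_ne_zero]
    exact Units.ne_zero _
  constructor
  · intro h
    rw [h, mul_zero]
  · intro h
    rcases mul_eq_zero.1 h with h' | h'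
    · exact absurd h' hu
    · exact h'

/-- **`F^a = (F^{n+1-a})^{⊥}`** as an equality of `ℂ`-submodules, the orthogonal being Mathlib's
`LinearMap.BilinForm.orthogonal` (`m ⊥ N` iff `Q_ℂ(y, m) = 0` for all `y ∈ N`).
[cite: VoisinHodgeI2002, §7.1.2 Def. 7.7 and §10.1.2] [cite: CarlsonMullerStachPeters2017, §4.4] -/
theorem F_eq_orthogonal (a : ℤ) :
    H.F a = (Q.form.baseChange ℂ).orthogonal (H.F (n + 1 - a)) := by
  ext x
  rw [LinearMap.BilinForm.mem_orthogonal_iff, Q.mem_F_iff_forall_form_eq_zero' a x]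

/-- Weight-`2` spelling used by the surface programme: **`F¹ = (F²)^⊥`** — the Hodge filtration of
a polarized weight-`2` structure is determined by `F² = V^{2,0}`.
[cite: VoisinHodgeI2002, §7.1.2 Def. 7.7] -/
theorem mem_F_one_iff_of_weight_two {H : HodgeStructure V 2} (Q : Polarization H) (x : ℂ ⊗[ℚ] V) :
    x ∈ H.F 1 ↔ ∀ y ∈ H.F 2, Q.form.baseChange ℂ x y = 0 := by
  have h := Q.mem_F_iff_forall_form_eq_zero 1 x
  rwa [show (2 : ℤ) + 1 - 1 = 2 by norm_num] at h

end Polarization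

end HodgeStructure

end Literature.AlgebraicGeometry.Motives

end
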